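import Summits.ResolutionOfSingularities.ResolutionOfSingularities.Theorems.EquisingularLiftEquisingularLiftNatMultisectionExists
import Summits.ResolutionOfSingularities.ResolutionOfSingularities.Theorems.EquisingularLiftEquisingularLiftNatMultisectionRational
import Summits.ResolutionOfSingularities.ResolutionOfSingularities.Theorems.EquisingularLiftEquisingularLiftNatCarrierDeltaComapFrame
import Literature.AlgebraicGeometry.Resolution.RegularParameterQuotient
import Literature.AlgebraicGeometry.Resolution.RegularCentreLocalCodim
import Literature.AlgebraicGeometry.Resolution.JacobianCriterion
import Literature.AlgebraicGeometry.Resolution.MarkedIdealsLemmas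
import Literature.AlgebraicGeometry.Resolution.AlterationsNormalFormBlowupFormal
import Literature.RingTheory.RegularLocalRing.QuotientDVR
import HarnessLib

/-!
# [OURS · L1 W4.5(b) · EL♮(3)] T-FATCENTRE — the upstairs centre of a CURVILINEAR FAT POINT step (`TowerPtRam` of …NatTowerDefs,
# p541504): a ramified multisection WITH THE PRIME PRESCRIBED, whose special fibre is EXACTLY the fat point `J` (clause (i♯))

Crux chain w45b (cell `res-hironaka`, slot W4.5(b)), working crux **EL♮** = stmt-ResolutionOfSingularities-20038, child **EL♮(3)** =
stmt-ResolutionOfSingularities-20148, route EquisingularLift, line `sections`, registered stub `stub_elnat_towerPointResolution`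
(rung TOWER, res-L1-w45b-lead-2 RESHAPE 2026-08-27T15:22:14Z, TOWER-INST p542565); upstairs debt HSUB′(ReachTower), supplier object
**T-FATCENTRE** (res-L1-w45b-plan-1 WORD 15:42:29Z «stub-2 ← W4.5b T-FATCENTRE», sizing CRUX-PLAN G3 (iii): re-assembly of T-MULTISEC
p509091 / p509839 / p510326). HONEST FRAMING: OURS; NOT a statement of any manuscript; AI-written, weaker than expert review.
No `sorry`; standard axioms. DEF-FREE. `--supports stmt-ResolutionOfSingularities-20148 --as helper`.

SETTING (the binders of a (pt-ram) step of the TOWER supplier): `O` a COMPLETE DVR with algebraically closed residue field, `θ : O ↠ k`,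
the upstairs stage `r : X → Spec O` (proper), the model square `jG : G → X` over `Spec θ` (`G` = the downstairs stage), a CLOSED point
`y ∈ G` with `𝒪_{X,jG y}` regular of dimension `n + 1`, and a CURVILINEAR FAT POINT `J` at `y`: `supp J = {y}`, `J_y = (ℓ₁, …, ℓ_n)`
with `ℓᵢ ∈ 𝔪_{G,y}` having LINEARLY INDEPENDENT classes in the cotangent space `𝔪_{G,y}/𝔪²_{G,y}` (the `TowerPtRam` clause with `n = 3`;
no regularity of `G` at `y` is assumed or needed).

WHAT.
* `exists_lift_linearIndependent_toCotangent` — the `ℓᵢ` lift along the surjective local homomorphism `jG♯_y : 𝒪_{X,jG y} ↠ 𝒪_{G,y}` to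
  `ℓ̃ᵢ ∈ 𝔪_{X,jG y}` with linearly independent cotangent classes (pull the ring-level independence back through a local homomorphism).
* `isPrime_span_lift_and_dvr` — `𝔭 := (ℓ̃₁, …, ℓ̃_n)` is a prime of the regular local ring `𝒪_{X,jG y}` (dimension `n + 1`) with
  `𝒪_{X,jG y}/𝔭` a DISCRETE VALUATION RING (Matsumura 14.2: regular of dimension `1`).
* `exists_mem_support_ne_of_isPrime`, `varpi_notMem_of_support_eq` — **the fat point is fat only downstairs**: `ϖ ∉ 𝔭`, BECAUSE `supp J = {y}` (were `ϖ ∈ 𝔭`,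
  `𝒪_{G,y}/J_y ≅ 𝒪_{X,jG y}/𝔭` would be a DVR and the generization of `y` along its generic point would lie in `supp J`).
* **`exists_fatCentre`** — T-FATCENTRE: there is an ideal sheaf `C` on `X` (the prime divisor of the point of `𝔭`, T-MULTISEC's
  `multisection_of_prime` with the prime PRESCRIBED) such that `V(C)` is INTEGRAL and REGULAR, `V(C) → Spec O` is FLAT, `supp C` meets the
  special fibre in `{jG y}` only, `C_{jG y} = (ℓ̃)` with `jG♯ ℓ̃ᵢ = ℓᵢ`, and **`C·𝒪_G = J`** — the special fibre of the centre IS the fat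
  point (clause (i♯) of the K5-FAT `Member`; the model-square input `C.comap j = D` of res-D-pv-029's `modelStep` for this step).

References: Matsumura, *Commutative Ring Theory*, Thm. 8.4, 11.2, 14.2 [Matsumura1987]; The Stacks Project, Tag 01W6 — through the cited
tree files (T-MULTISEC …NatMultisection / …NatMultisectionRational / …NatMultisectionExists, res-D-pv-003 and res-L1-w45b lineage;
`RegularParameterQuotient`, `RegularCentreLocalCodim`, `JacobianCriterion`, `QuotientDVR`, `MarkedIdealsLemmas`). OURS planning texts
(index only): …NatTowerDefs docstring (`TowerPtRam`), PLANNER-MEMO-g11-1 §3, CRUX-PLAN v3.9 G3 (iii).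
-/

set_option linter.dupNamespace false -- mandated namespace `Summit.<Summit>.<Problem>` of this single-conjunct summit
set_option linter.overlappingInstances false -- the binders carry `[IsDomain O] [IsDiscreteValuationRing O]`

noncomputable section

open CategoryTheory CategoryTheory.Limits AlgebraicGeometry TopologicalSpace Topology IsLocalRing
open Literature.AlgebraicGeometry.Resolution
open Literature.RingTheory.RegularLocalRing
open AlgebraicGeometry.Scheme.IdealSheafData

namespace Summit.ResolutionOfSingularities.ResolutionOfSingularities.Cruxes.EquisingularLiftNat.Sections

universe u

/-! ## 1. Lifting cotangent-independent families along a surjective local homomorphism -/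

/-- **Cotangent independence lifts along a surjective local homomorphism.** `φ : R → S` a surjective local homomorphism of local rings,
`ℓ : Fin n → 𝔪_S` with linearly independent classes in `𝔪_S/𝔪_S²`: there are lifts `ℓ̃ᵢ ∈ 𝔪_R`, `φ ℓ̃ᵢ = ℓᵢ`, with linearly
independent classes in `𝔪_R/𝔪_R²` (a relation `∑ αᵢ ℓ̃ᵢ ∈ 𝔪_R²` maps to `∑ φ(αᵢ) ℓᵢ ∈ 𝔪_S²`, so `φ αᵢ ∈ 𝔪_S`, so `αᵢ ∈ 𝔪_R`).
[cite: Matsumura1987, Thm. 14.2] -/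
theorem exists_lift_linearIndependent_toCotangent {R S : Type u} [CommRing R] [CommRing S] [IsLocalRing R] [IsLocalRing S]
    (φ : R →+* S) [IsLocalHom φ] (hφ : Function.Surjective φ) {n : ℕ} (ℓ : Fin n → S)
    (hℓ : ∀ i, ℓ i ∈ maximalIdeal S)
    (hli : LinearIndependent (ResidueField S) fun i => (maximalIdeal S).toCotangent ⟨ℓ i, hℓ i⟩) :
    ∃ (ℓ' : Fin n → R) (hℓ' : ∀ i, ℓ' i ∈ maximalIdeal R), (∀ i, φ (ℓ' i) = ℓ i) ∧
      LinearIndependent (ResidueField R) fun i => (maximalIdeal R).toCotangent ⟨ℓ' i, hℓ' i⟩ := by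
  choose ℓ' hℓ'φ using fun i => hφ (ℓ i)
  have hℓ' : ∀ i, ℓ' i ∈ maximalIdeal R := fun i => by
    rw [mem_maximalIdeal, mem_nonunits_iff]
    intro hu
    have h := hu.map φ
    rw [hℓ'φ i] at h
    exact ((mem_maximalIdeal _).mp (hℓ i)) h
  refine ⟨ℓ', hℓ', hℓ'φ, linearIndependent_toCotangent_of_forall_family ℓ' hℓ' fun α hα i => ?_⟩
  -- push the relation down
  have hα' : ∑ j, φ (α j) * ℓ j ∈ maximalIdeal S ^ 2 := by
    have h := Ideal.mem_map_of_mem φ hα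
    rw [map_sum] at h
    simp only [map_mul, hℓ'φ] at h
    have hle : (maximalIdeal R ^ 2).map φ ≤ maximalIdeal S ^ 2 := by
      rw [Ideal.map_pow]
      exact Ideal.pow_right_mono (((IsLocalRing.local_hom_TFAE φ).out 0 2).mp ‹_›) 2
    exact hle h
  have hφα := forall_mem_maximalIdeal_of_linearIndependent_toCotangent ℓ hℓ hli (fun j => φ (α j)) hα' i
  rw [mem_maximalIdeal, mem_nonunits_iff] at hφα ⊢
  exact fun hu => hφα (hu.map φ)

/-! ## 2. The prescribed prime `𝔭 = (ℓ̃)` of the regular local ring upstairs -/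

/-- **`(ℓ̃₁, …, ℓ̃_n)` is a prime with DVR quotient** in a regular local ring of dimension `n + 1`, for `ℓ̃ᵢ ∈ 𝔪` with linearly
independent cotangent classes (Matsumura 14.2: the quotient is regular of dimension `(n + 1) - n = 1`, hence a DVR, Matsumura 11.2).
[cite: Matsumura1987, Thm. 14.2; Matsumura1987, Thm. 11.2] -/
theorem isPrime_span_lift_and_dvr {R : Type u} [CommRing R] [IsRegularLocalRing R] {n : ℕ}
    (hdim : ringKrullDim R = ((n + 1 : ℕ) : WithBot ℕ∞)) (ℓ' : Fin n → R) (hℓ' : ∀ i, ℓ' i ∈ maximalIdeal R)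
    (hli : LinearIndependent (ResidueField R) fun i => (maximalIdeal R).toCotangent ⟨ℓ' i, hℓ' i⟩) :
    ∃ (_ : (Ideal.span (Set.range ℓ')).IsPrime) (_ : IsDomain (R ⧸ Ideal.span (Set.range ℓ'))),
      IsDiscreteValuationRing (R ⧸ Ideal.span (Set.range ℓ')) ∧ IsRegularLocalRing (R ⧸ Ideal.span (Set.range ℓ')) ∧
      ringKrullDim (R ⧸ Ideal.span (Set.range ℓ')) = 1 := by
  obtain ⟨hreg, hdim'⟩ := RegularParameters.isRegularLocalRing_quotient_span_range ℓ' hℓ'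
    (forall_mem_maximalIdeal_of_linearIndependent_toCotangent ℓ' hℓ' hli)
  haveI := hreg
  have h1 : ringKrullDim (R ⧸ Ideal.span (Set.range ℓ')) = 1 := by
    rw [hdim] at hdim'
    obtain ⟨m, hm⟩ := exists_nat_cast_eq_ringKrullDim (R := R ⧸ Ideal.span (Set.range ℓ'))
    rw [hm] at hdim' ⊢
    have hmn : m + n = n + 1 := by exact_mod_cast hdim'
    have hm1 : m = 1 := by omega
    subst hm1
    rfl
  haveI hdom := isDomain_of_isRegularLocalRing (R ⧸ Ideal.span (Set.range ℓ'))
  exact ⟨(Ideal.Quotient.isDomain_iff_prime _).mp hdom, hdom, isDiscreteValuationRing_of_ringKrullDim_eq_one h1, hreg, h1⟩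

/-! ## 3. The fat point is fat only downstairs: `ϖ ∉ (ℓ̃)` from `supp J = {y}` -/

/-- If an ideal `J_y` of the local ring of a point `y` is a prime DIFFERENT from the maximal ideal, the ideal sheaf `J` has a point of
its support other than `y` (the image of `J_y` under `Spec 𝒪_{G,y} → G`). [folklore] -/
theorem exists_mem_support_ne_of_isPrime {G : Scheme.{u}} (J : G.IdealSheafData) (y : G) (h𝔮 : (stalkIdeal J y).IsPrime)
    (hne : stalkIdeal J y ≠ maximalIdeal (G.presheaf.stalk y)) : ∃ y' ∈ (J.support : Set G), y' ≠ y := by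
  let 𝔮 : Spec (G.presheaf.stalk y) := ⟨stalkIdeal J y, h𝔮⟩
  refine ⟨G.fromSpecStalk y 𝔮, (fromSpecStalk_mem_support_iff y J 𝔮).mpr le_rfl, fun h => hne ?_⟩
  have hinj : Function.Injective (G.fromSpecStalk y) := (G.fromSpecStalk y).isEmbedding.injective
  have h2 : 𝔮 = closedPoint (G.presheaf.stalk y) := hinj (h.trans Scheme.fromSpecStalk_closedPoint.symm)
  exact congrArg PrimeSpectrum.asIdeal h2

/-- **The fat point is fat only downstairs.** In the model square over the DVR `O` (uniformizer `ϖ`, germ `ι ϖ ∈ 𝒪_{X,jG y}`): if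
`supp J = {y}`, `J_y = jG♯(𝔭)` for an ideal `𝔭 ∋ ` the lifts, and `𝒪_{X,jG y}/𝔭` is a discrete valuation ring, then `ι ϖ ∉ 𝔭`.
(Otherwise `ker jG♯_y = (ι ϖ) ⊆ 𝔭`, so `𝒪_{G,y}/J_y ≅ 𝒪_{X,jG y}/𝔭` is a DVR: `J_y` is a non-maximal prime, and `supp J` contains a second
point.) [folklore] -/
theorem varpi_notMem_of_support_eq (O : Type) [CommRing O] [IsDomain O] [IsDiscreteValuationRing O] (k : Type) [Field k]
    (θ : O →+* k) (hθ : Function.Surjective θ) {X G : Scheme.{0}} (r : X ⟶ Spec (.of O)) (jG : G ⟶ X) (tG : G ⟶ Spec (.of k))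
    (hsq : IsPullback jG tG r (Spec.map (CommRingCat.ofHom θ))) (y : G) (ϖ : O) (hϖ : Irreducible ϖ)
    (J : G.IdealSheafData) (hJsupp : (J.support : Set G) = {y})
    (𝔭 : Ideal (X.presheaf.stalk (jG y))) [𝔭.IsPrime] [IsDiscreteValuationRing (X.presheaf.stalk (jG y) ⧸ 𝔭)]
    (hJ𝔭 : stalkIdeal J y = 𝔭.map (jG.stalkMap y).hom) :
    (X.presheaf.Γgerm (jG y)).hom (r.appTop.hom ((Scheme.ΓSpecIso (.of O)).inv.hom ϖ)) ∉ 𝔭 := by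
  intro hϖ𝔭
  set φ := (jG.stalkMap y).hom with hφdef
  have hφsurj : Function.Surjective φ := stalkMap_model_surjective θ hθ r jG tG hsq y
  have hker : RingHom.ker φ ≤ 𝔭 :=
    (ker_stalkMap_model_le O k θ hθ r jG tG hsq y ϖ hϖ).trans ((Ideal.span_singleton_le_iff_mem _).mpr hϖ𝔭)
  -- `𝒪_{G,y}/J_y ≅ 𝒪_{X,jG y}/𝔭`
  have hcomap : (stalkIdeal J y).comap φ = 𝔭 := by
    rw [hJ𝔭, Ideal.comap_map_of_surjective φ hφsurj, sup_eq_left]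
    rwa [← RingHom.ker_eq_comap_bot]
  have hkerc : RingHom.ker ((Ideal.Quotient.mk (stalkIdeal J y)).comp φ) = 𝔭 := by
    rw [← RingHom.comap_ker, Ideal.mk_ker, hcomap]
  let e : (X.presheaf.stalk (jG y) ⧸ 𝔭) ≃+* (G.presheaf.stalk y ⧸ stalkIdeal J y) :=
    (Ideal.quotEquivOfEq hkerc.symm).trans
      (RingHom.quotientKerEquivOfSurjective (f := (Ideal.Quotient.mk (stalkIdeal J y)).comp φ)
        (Ideal.Quotient.mk_surjective.comp hφsurj))
  haveI : IsDomain (G.presheaf.stalk y ⧸ stalkIdeal J y) := MulEquiv.isDomain (X.presheaf.stalk (jG y) ⧸ 𝔭) e.symm.toMulEquiv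
  have hprime : (stalkIdeal J y).IsPrime := (Ideal.Quotient.isDomain_iff_prime _).mp inferInstance
  have hne : stalkIdeal J y ≠ maximalIdeal (G.presheaf.stalk y) := by
    intro hmax
    -- then `𝒪_{G,y}/J_y` is a field, so `𝒪_{X}/𝔭` is a field: not a DVR
    have hfield : IsField (G.presheaf.stalk y ⧸ stalkIdeal J y) := by
      rw [hmax]; exact (Ideal.Quotient.maximal_ideal_iff_isField_quotient _).mp (maximalIdeal.isMaximal _)
    have hfield' : IsField (X.presheaf.stalk (jG y) ⧸ 𝔭) := MulEquiv.isField hfield e.toMulEquiv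
    exact IsDiscreteValuationRing.not_isField _ hfield'
  obtain ⟨y', hy', hy'y⟩ := exists_mem_support_ne_of_isPrime J y hprime hne
  rw [hJsupp] at hy'
  exact hy'y hy'

/-! ## 4. T-FATCENTRE -/

/-- **T-FATCENTRE — the upstairs centre of a curvilinear fat point step, with the prime prescribed.** `O` a complete DVR with
algebraically closed residue field, `θ : O ↠ k`, `r : X → Spec O` proper, `jG : G → X` the model square over `Spec θ`, `y ∈ G` closed
with `𝒪_{X,jG y}` regular of dimension `n + 1`, and `J` a CURVILINEAR FAT POINT at `y` (`supp J = {y}`, `J_y = (ℓ₁, …, ℓ_n)`, `ℓᵢ ∈ 𝔪`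
with linearly independent cotangent classes — the `TowerPtRam` clause of …NatTowerDefs, `n = 3`). THEN there is an ideal sheaf `C` on `X`
with `V(C)` integral and regular, `V(C) → Spec O` flat, `supp C ∩ X_s = {jG y}`, `C_{jG y} = (ℓ̃)` for lifts `ℓ̃ᵢ` of the `ℓᵢ`, and
`C·𝒪_G = J`: the ramified multisection `Spec 𝒪_{X,jG y}/(ℓ̃)` whose special fibre IS the fat point.
[cite: Matsumura1987, Thm. 8.4; Matsumura1987, Thm. 14.2] [OURS · L1 W4.5b · T-FATCENTRE] -/
theorem exists_fatCentre (O : Type) [CommRing O] [IsDomain O] [IsDiscreteValuationRing O] [IsAdicComplete (maximalIdeal O) O]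
    [IsAlgClosed (ResidueField O)] (k : Type) [Field k] (θ : O →+* k) (hθ : Function.Surjective θ)
    {X : Scheme.{0}} (r : X ⟶ Spec (.of O)) [IsProper r]
    {G : Scheme.{0}} (jG : G ⟶ X) (tG : G ⟶ Spec (.of k)) (hsq : IsPullback jG tG r (Spec.map (CommRingCat.ofHom θ)))
    (y : G) (hyc : IsClosed ({y} : Set G)) {n : ℕ}
    (hreg : IsRegularLocalRing (X.presheaf.stalk (jG y)))
    (hdim : ringKrullDim (X.presheaf.stalk (jG y)) = ((n + 1 : ℕ) : WithBot ℕ∞))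
    (J : G.IdealSheafData) (hJsupp : (J.support : Set G) = {y})
    (ℓ : Fin n → G.presheaf.stalk y) (hℓ : ∀ i, ℓ i ∈ maximalIdeal (G.presheaf.stalk y))
    (hJℓ : stalkIdeal J y = Ideal.span (Set.range ℓ))
    (hli : LinearIndependent (ResidueField (G.presheaf.stalk y)) fun i => (maximalIdeal (G.presheaf.stalk y)).toCotangent ⟨ℓ i, hℓ i⟩) :
    ∃ (C : X.IdealSheafData) (ℓ' : Fin n → X.presheaf.stalk (jG y)),
      AlgebraicGeometry.IsIntegral C.subscheme ∧ Scheme.IsRegular C.subscheme ∧ Flat (C.subschemeι ≫ r) ∧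
      (C.support : Set X) ∩ r ⁻¹' {closedPoint O} = {jG y} ∧
      (∀ i, (jG.stalkMap y).hom (ℓ' i) = ℓ i) ∧ stalkIdeal C (jG y) = Ideal.span (Set.range ℓ') ∧
      C.comap jG = J := by
  classical
  haveI : IsClosedImmersion (Spec.map (CommRingCat.ofHom θ)) := IsClosedImmersion.spec_of_surjective _ hθ
  haveI : IsClosedImmersion jG := MorphismProperty.IsStableUnderBaseChange.of_isPullback hsq.flip inferInstance
  obtain ⟨ϖ, hϖ⟩ := IsDiscreteValuationRing.exists_irreducible O
  have hϖO : ϖ ∈ maximalIdeal O := by rw [hϖ.maximalIdeal_eq]; exact Ideal.mem_span_singleton_self ϖ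
  -- every point of `G` lies over the closed point
  have hspecial : ∀ y'' : G, r (jG y'') = closedPoint O := fun y'' => by
    have h : jG y'' ∈ Set.range jG := ⟨y'', rfl⟩
    rw [range_eq_preimage_of_isPullback hsq, range_specMap_of_surjective_of_field θ hθ] at h
    exact h
  have hb : r (jG y) = closedPoint O := hspecial y
  have hbc : IsClosed ({jG y} : Set X) := by
    rw [← Set.image_singleton]; exact jG.isClosedEmbedding.isClosedMap _ hyc
  -- (1) lift the fat point's generators
  have hφsurj : Function.Surjective (jG.stalkMap y).hom := stalkMap_model_surjective θ hθ r jG tG hsq y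
  obtain ⟨ℓ', hℓ', hℓ'φ, hli'⟩ := exists_lift_linearIndependent_toCotangent (jG.stalkMap y).hom hφsurj ℓ hℓ hli
  -- (2) the prescribed prime, with DVR quotient
  haveI := hreg
  obtain ⟨hp, hdom, hdvr, -, -⟩ := isPrime_span_lift_and_dvr hdim ℓ' hℓ' hli'
  haveI := hp
  haveI := hdvr
  -- `J_y = jG♯((ℓ̃))`
  have hJmap : stalkIdeal J y = (Ideal.span (Set.range ℓ')).map (jG.stalkMap y).hom := by
    rw [hJℓ, Ideal.map_span, ← Set.range_comp]
    have h : ((jG.stalkMap y).hom ∘ ℓ') = ℓ := funext hℓ'φ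
    rw [h]
  -- (3) `ϖ ∉ (ℓ̃)`
  have hne : ∃ a ∈ maximalIdeal O, Ideal.Quotient.mk (Ideal.span (Set.range ℓ')) (((Scheme.ΓSpecIso (.of O)).inv ≫
      (Spec (.of O)).presheaf.germ ⊤ (r (jG y)) trivial ≫ r.stalkMap (jG y)).hom a) ≠ 0 := by
    refine ⟨ϖ, hϖO, fun h0 => ?_⟩
    rw [Ideal.Quotient.eq_zero_iff_mem] at h0
    refine varpi_notMem_of_support_eq O k θ hθ r jG tG hsq y ϖ hϖ J hJsupp (Ideal.span (Set.range ℓ')) hJmap ?_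
    have h1 := Summit.ResolutionOfSingularities.ResolutionOfSingularities.Cruxes.EquisingularLift.StrataSplit.stalkMap_Γgerm_apply'
      r (jG y) ((Scheme.ΓSpecIso (.of O)).inv.hom ϖ)
    rw [← h1]
    exact h0
  -- (4) `k`-rationality and T-MULTISEC's package with the prime prescribed
  have hres := residue_comp_stalkHom_surjective r hbc hb
  obtain ⟨-, -, hsf, hint, hCreg, hflat, hstalk⟩ := multisection_of_prime r hb hres (Ideal.span (Set.range ℓ')) hne
  refine ⟨_, ℓ', hint, hCreg, hflat, hsf, hℓ'φ, hstalk, ?_⟩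
  -- (5) the special fibre of the centre is the fat point: compare stalks
  refine ext_of_forall_stalkIdeal_eq fun y'' => ?_
  by_cases hy'' : y'' = y
  · subst hy''
    rw [stalkIdeal_comap_eq_map_stalkMap, hstalk, ← hJmap]
  · -- off `y` both sides are the unit ideal
    have hJtop : stalkIdeal J y'' = ⊤ := by
      by_contra h
      have hmem : y'' ∈ (J.support : Set G) :=
        (mem_support_iff_stalkIdeal_le J y'').mpr (IsLocalRing.le_maximalIdeal h)
      rw [hJsupp] at hmem
      exact hy'' hmem
    have hCtop : stalkIdeal (primeDivisorIdeal (X.fromSpecStalk (jG y) ⟨Ideal.span (Set.range ℓ'), hp⟩)) (jG y'') = ⊤ := by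
      by_contra h
      have hmem : jG y'' ∈ ((primeDivisorIdeal (X.fromSpecStalk (jG y) ⟨Ideal.span (Set.range ℓ'), hp⟩)).support : Set X) ∩
          r ⁻¹' {closedPoint O} :=
        ⟨(mem_support_iff_stalkIdeal_le _ _).mpr (IsLocalRing.le_maximalIdeal h), hspecial y''⟩
      rw [hsf] at hmem
      exact hy'' (jG.isClosedEmbedding.injective hmem)
    rw [stalkIdeal_comap_eq_map_stalkMap, hCtop, hJtop, Ideal.map_top]

end Summit.ResolutionOfSingularities.ResolutionOfSingularities.Cruxes.EquisingularLiftNat.Sections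

end
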